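import Summits.NavierStokesRegularity.FluidComputer.PalasekTowerEpisodes
import Summits.NavierStokesRegularity.FluidComputer.PalasekTowerLedger

/-!
# The depth ladder of Palasek's Step 2: registered numbers, uniform finite depth, compactness

Cell `ns-blowup`, seat `ns-blowup-ecbridge-1` (g2); companion of `PalasekTowerEpisodes.lean`
(p404510: `Schedule`, `Stage`, `Realisation.ofEpisodes`) and `PalasekTowerEpisodesPinned.lean`
(p406175, seat `ns-blowup-lean`: `Schedule.Pins`, `Margins.withStrain`, K1R/K2R =
`EpisodeBasePinned` / `EpisodeInductionPinned`). LABEL: E-C typing; WHAT THIS IS NOT: not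
Navier–Stokes evidence, not a construction — nothing below asserts that any tower exists.

## Why a second shape

The refuter's K-probe (STATUS l.911, `refuter/KPROBE-EPISODES.md`; referee concurs) killed the
first split twice: (K-A) the base was junk-inhabited, (K-B) the induction step, quantified over
EVERY schedule, was refuted by a foreign junk schedule plus the chain's own uniqueness debt `hU`.
The re-pin (`Schedule.Pins`: impulse and separation pins, confinement; strain floor) answers
(K-A). For (K-B) it restricts the universal quantifier to PINNED schedules and says openly that
the residual content is heredity ROBUST against every admissible force. This file types the
other admissible answer to (K-B) — the one with NO universal quantifier over schedules at all —
so that the filer can choose, and proves how the two shapes interlock: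

* §1 `Registry R` — the registered NUMBERS (envelope constants, radius, `Λ`, `θ`, persistence
  fraction `κ`); `ClayEnvelope` — uniform Clay envelopes for datum and force and time brackets,
  chosen ONCE for all depths; `Schedule.Conforms P V S` — the schedule uses exactly the registered
  numbers, lies in the envelope, and satisfies the re-pin's pins at `(P.Λ, P.θ)` (stated field by
  field; this file imports only the episode files, because the re-pin's olean is not yet built on
  the farm — the companion `PalasekTowerDepthPinned.lean` proves the interlock by name).
* §2 `Margins.persist κ` — PERSISTENCE of every grown level through the next inter-readout
  interval (Palasek's trapping region; transient superpositions are not levels); the registered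
  margin of this shape is `Margins.tower R κ` = the re-pin's strain floor on top of persistence
  (definitionally `Margins.withStrain (Margins.persist R κ)`); both clauses are closed under
  locally uniform `C¹` limits.
* §3 THE LADDER: `DepthTower ν R P V m K` (a conforming schedule with a stage at level `K` — the
  finite rungs the cell's CAP / MODEL lanes can certify level by level; `DepthTower.mono`), K1R-E
  `UniformDepthTowers` (:= ∃ envelope, ∀ K, a tower of depth `K+1` — ALL the finite-depth physics,
  EXISTENTIAL in the schedule: no foreign schedule and no uniqueness theorem can attack it),
  `CoherentTower` (one conforming schedule with a coherent infinite chain of stages), K2R-E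
  `TowerCompactness` (:= K1R-E → CoherentTower; Arzelà–Ascoli on the uniformly Clay data and
  forces, parabolic regularity and continuous dependence from the REGISTERED ceilings, diagonal
  subsequence, closedness of every clause — folklore-grade for limit-closed margins; an
  implication, hence consistent with `hU`).
* §4 THE ASSEMBLY is the gluing of a GIVEN coherent chain, proved once for all shapes in the
  sibling `PalasekTowerChainGluing.lean` (`Realisation.ofChain`, `nonempty_realisation_of_chain`);
  the corollaries `K1R-E → K2R-E → Nonempty (Realisation ν R)` / `→ PalasekStep2 R` / `→ (C)`
  (modulo W21′) are one-liners over it and live in `PalasekTowerDepthAssembly.lean` (filed when the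
  farm has built both oleans; ≤ 400-line rule).
* §5 HEREDITY OF THE PRODUCED OBJECT'S CLASS (repair R-d made literal): `BaseIn 𝒟`,
  `HereditaryIn 𝒟` for a DESIGN CLASS `𝒟` of schedules (the constructor's explicit family — to be
  registered when a mechanism of record exists); `coherentTower_of_hereditaryIn` (by the landed
  `Assembly.chain`). (Companion file: the re-pinned induction `EpisodeInductionPinned` is heredity
  in EVERY class of conforming schedules, and a depth-one tower is a re-pinned base — the two
  shapes compose.)
* §6 Non-vacuity of the registry: `TowerRates.deep` (`N₀ = 2^{16}`, `4 Y_k ≤ Y_{k+1}`),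
  `Registry.deep` (`c₂ = 2 c₁`, `Λ = 4`, `θ = 2`).

References: S. Palasek, arXiv:2605.13827 §3.3–§4 [cite: Palasek2026ElementaryModel, §3.3–§4];
C. L. Fefferman, Clay problem description, (C) (4) (5) [cite: FeffermanClay2006, (C)];
J. T. Beale, T. Kato, A. Majda, Comm. Math. Phys. 94 (1984) §1 [cite: BealeKatoMajda1984, §1].
-/

noncomputable section

namespace Summit.NavierStokesRegularity.FluidComputer.PalasekTowerClayBridge

open Set MeasureTheory Filter Topology Function
open scoped ENNReal ContDiff NNReal
open Literature.Analysis.FluidPDE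

/-! ## §1 Registered numbers, uniform Clay envelopes, conforming schedules -/

/-- **The REGISTRY for the rates `R`**: the envelope constants `c₁ … c₅`, the ball radius, the
impulse and separation numbers `Λ`, `θ` of `Schedule.Pins`, and the persistence fraction `κ` are
registered NUMBERS — a conforming schedule uses exactly these (so "uniformly in the depth" has a
meaning, and the dilation / free-constant levers of the K-probe are gone at the level of the
class, not of one schedule). [cite: Palasek2026ElementaryModel, §3.3] -/
structure Registry (R : TowerRates) where
  /-- floor constant -/
  c₁ : ℝ
  /-- ceiling constant -/
  c₂ : ℝ
  /-- clock constant -/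
  c₃ : ℝ
  /-- push-size constant -/
  c₄ : ℝ
  /-- visibility-window constant -/
  c₅ : ℝ
  /-- radius of the ball carrying the tower -/
  radius : ℝ
  /-- impulse number of `Schedule.Pins` (refuter: `≥ 3`) -/
  Λ : ℝ
  /-- separation number of `Schedule.Pins` (`≥ 1`; `> 1` needs a wide base, `TowerRates.wide`) -/
  θ : ℝ
  /-- persistence fraction of `Margins.persist` -/
  κ : ℝ
  c₁_pos : 0 < c₁
  c₁_le_c₂ : c₁ ≤ c₂
  radius_pos : 0 < radius
  Λ_nonneg : 0 ≤ Λ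
  one_le_θ : 1 ≤ θ
  κ_pos : 0 < κ

/-- **Uniform Clay envelopes and time brackets** (chosen ONCE by the constructor, for all depths —
the uniformity compactness needs): `D n K` bounds `(1+|x|)^K ‖D^n u₀(x)‖` (Fefferman (4)), `F n K`
bounds `(1+|x|+t)^K ‖D^n f(t,x)‖` on the closed half-space (Fefferman (5)); the first readout is at
least `t₀ > 0` and the blow-up time at most `Tmax`. [cite: FeffermanClay2006, (4) (5)] -/
structure ClayEnvelope where
  /-- datum envelope -/
  D : ℕ → ℕ → ℝ
  /-- force envelope -/
  F : ℕ → ℕ → ℝ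
  /-- lower time bracket for `τ 0` -/
  t₀ : ℝ
  /-- upper time bracket for `T` -/
  Tmax : ℝ
  t₀_pos : 0 < t₀

/-- **A schedule CONFORMS to the registry `P` within the envelope `V`**: its constants and radius
ARE the registered numbers, its times lie in the brackets, its datum and force lie inside the
uniform Clay envelopes, and it satisfies the re-pin's `Schedule.Pins` at `(P.Λ, P.θ)` — stated
field by field (impulse pin, separation pin, confinement of datum and force to the ball) so that
this file's import closure stays at the episode files; `Schedule.Conforms.pins` in the companion
`PalasekTowerDepthPinned.lean` repackages them. [cite: Palasek2026ElementaryModel, §3.3] -/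
structure Schedule.Conforms {R : TowerRates} (P : Registry R) (V : ClayEnvelope) (S : Schedule R) :
    Prop where
  c₁_eq : S.c₁ = P.c₁
  c₂_eq : S.c₂ = P.c₂
  c₃_eq : S.c₃ = P.c₃
  c₄_eq : S.c₄ = P.c₄
  c₅_eq : S.c₅ = P.c₅
  radius_eq : S.radius = P.radius
  t₀_le : V.t₀ ≤ S.τ 0
  T_le : S.T ≤ V.Tmax
  datum_env : ∀ n K x, (1 + ‖x‖) ^ K * ‖iteratedFDeriv ℝ n S.u₀ x‖ ≤ V.D n K
  force_env : ∀ n K t, 0 ≤ t → ∀ x,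
    (1 + ‖x‖ + t) ^ K *
      ‖iteratedFDerivWithin ℝ n (uncurry S.f) (Ici (0 : ℝ) ×ˢ univ) (t, x)‖ ≤ V.F n K
  /-- impulse pin (re-pin R-a, interval form; = `Schedule.Pins.impulse` at `(P.Λ, P.θ)`) -/
  impulse : ∀ k, P.Λ * (S.c₄ * R.Y k) * (S.τ (k + 1) - S.τ k) ≤ S.c₁ * R.Y (k + 1) - S.c₂ * R.Y k
  /-- separation pin (= `Schedule.Pins.sep`) -/
  sep : ∀ k, P.θ * (S.c₂ * R.Y k) ≤ S.c₁ * R.Y (k + 1)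
  /-- the datum is confined to the ball (= `Schedule.Pins.datum_confined`) -/
  datum_confined : ∀ x, S.radius < ‖x‖ → S.u₀ x = 0
  /-- the force is confined to the ball (= `Schedule.Pins.force_confined`) -/
  force_confined : ∀ t x, S.radius < ‖x‖ → S.f t x = 0

/-! ## §2 The persistence margin -/

/-- **PERSISTENCE margin** (limit-closed): at a stage of level `k`, every grown level `j < k` keeps
a velocity floor `κ Y_j` somewhere in the ball THROUGHOUT the inter-readout interval
`[τ j, τ (j+1)]` — the parent is present while the child grows (Palasek's trapping region
`x_j ∈ [¾A_j, 2A_j]` up to the blow-up time, here only up to the next readout); a transient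
superposition that peaks at `τ j` and disperses is not a level. [cite: Palasek2026ElementaryModel, §3.3] -/
def Margins.persist (R : TowerRates) (κ : ℝ) : Margins R := fun S k u =>
  ∀ j, j + 1 ≤ k → ∀ t ∈ Icc (S.τ j) (S.τ (j + 1)), ∃ x, ‖x‖ ≤ S.radius ∧ κ * R.Y j ≤ ‖u t x‖

/-- **The registered margin of this shape**: the re-pin's STRAIN floor (`∃ x` in the ball with
`c₁ A_j ≤ ‖∇u(τ_j)(x)‖` for every grown level, verbatim the clause of `Margins.withStrain`) on top
of persistence — definitionally `Margins.withStrain (Margins.persist R κ)` (companion file). [folklore] -/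
def Margins.tower (R : TowerRates) (κ : ℝ) : Margins R := fun S k u =>
  (∀ j, j ≤ k → ∃ x, ‖x‖ ≤ S.radius ∧ S.c₁ * R.A j ≤ ‖fderiv ℝ (u (S.τ j)) x‖) ∧
    Margins.persist R κ S k u

/-- The registered margin is monotone in the level. [folklore] -/
theorem Margins.tower_mono {R : TowerRates} {κ : ℝ} {S : Schedule R} {k k' : ℕ} (hk : k ≤ k')
    {u : ℝ → EuclideanSpace ℝ (Fin 3) → EuclideanSpace ℝ (Fin 3)}
    (h : Margins.tower R κ S k' u) : Margins.tower R κ S k u :=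
  ⟨fun j hj => h.1 j (le_trans hj hk), fun j hj => h.2 j (le_trans hj hk)⟩

/-! ## §3 The ladder: finite depth, uniform depth, coherent towers, compactness -/

/-- **A tower of depth `K`** for the registry `P` within the envelope `V` (open for every `K ≥ 1`;
never asserted): some CONFORMING schedule admits a stage at level `K` — levels `0 … K` grown per the
registered envelope under the impulse / separation / confinement pins, margins `m`. The finite
rungs of the ladder. [cite: Palasek2026ElementaryModel, §4] -/
@[conjecture] def DepthTower (ν : ℝ) (R : TowerRates) (P : Registry R) (V : ClayEnvelope)
    (m : Margins R) (K : ℕ) : Prop :=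
  ∃ S : Schedule R, S.Conforms P V ∧ Nonempty (Stage ν R S m K)

/-- **K1R-E — UNIFORM FINITE-DEPTH TOWERS (open; never asserted here).** Some uniform Clay envelope
admits conforming towers of EVERY finite depth: `∃ V, ∀ K, DepthTower ν R P V m (K+1)`. All the
finite-depth physics of Palasek's Step 2 is here, EXISTENTIALLY in the schedule — refuting it
means proving that deep conforming towers do not exist; no foreign or seedless schedule and no
uniqueness theorem bears on it. [cite: Palasek2026ElementaryModel, §4] -/
@[conjecture] def UniformDepthTowers (ν : ℝ) (R : TowerRates) (P : Registry R) (m : Margins R) :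
    Prop :=
  ∃ V : ClayEnvelope, ∀ K : ℕ, DepthTower ν R P V m (K + 1)

/-- **A coherent infinite tower** (open; never asserted): ONE conforming schedule with stages at
every level, each extending the previous one (same velocity and pressure on the earlier slab).
[cite: Palasek2026ElementaryModel, §4] -/
@[conjecture] def CoherentTower (ν : ℝ) (R : TowerRates) (P : Registry R) (m : Margins R) : Prop :=
  ∃ V : ClayEnvelope, ∃ S : Schedule R, S.Conforms P V ∧
    ∃ s : (n : ℕ) → Stage ν R S m (n + 1), ∀ n, (s n).Extends (s (n + 1))

/-- **K2R-E — TOWER COMPACTNESS (open here; folklore-grade for limit-closed margins; never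
asserted).** A uniform family of finite-depth towers yields a coherent infinite tower. Proof plan
(not formalised): data and forces lie in the FIXED envelopes of `V`, so a subsequence converges in
`C^∞_loc` (Arzelà–Ascoli); readout times lie in `[t₀, Tmax]`, so a further subsequence of
`(T^{(K)}, τ^{(K)})` converges, and the registered ceilings `c₂ Y_k` against the floors
`c₁ Y_{k+1} ≥ θ c₂ Y_k` with uniform `C¹` bounds keep the limit times strictly increasing; on each
slab `[0, τ k]` the solutions are bounded by `c₂ Y_k` uniformly in `K`, hence (parabolic regularity
for bounded classical solutions, continuous dependence) converge in `C^∞_loc` along a diagonal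
subsequence to a classical solution of the limit data — ONE solution, restricted to the slabs, so
the chain is coherent; floors, ceilings, quiet, strain, persistence, energy, clock, pins and
envelopes are closed conditions. An IMPLICATION: consistent with any uniqueness theorem. For a
margin not closed under such limits it may fail; `Margins.tower` is closed. [folklore] -/
@[conjecture] def TowerCompactness (ν : ℝ) (R : TowerRates) (P : Registry R) (m : Margins R) :
    Prop :=
  UniformDepthTowers ν R P m → CoherentTower ν R P m

/-- Restriction of a stage to an earlier level, for the registered margin. [folklore] -/
def Stage.restrict {ν : ℝ} {R : TowerRates} {S : Schedule R} {κ : ℝ} {k k' : ℕ} (hk : k ≤ k')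
    (s : Stage ν R S (Margins.tower R κ) k') : Stage ν R S (Margins.tower R κ) k where
  u := s.u
  p := s.p
  classical := s.classical.mono (Icc_subset_Icc_right (S.τ_mono hk)) (uniqueDiffOn_Icc (S.τ_pos k))
  initial := s.initial
  energy := by
    obtain ⟨C, hC, hb⟩ := s.energy
    exact ⟨C, hC, fun t ht => hb t ⟨ht.1, le_trans ht.2 (S.τ_mono hk)⟩⟩
  floor j hj := s.floor j (le_trans hj hk)
  ceiling j hj := s.ceiling j (le_trans hj hk)
  quiet j hj := s.quiet j (le_trans hj hk)
  margin := Margins.tower_mono hk s.margin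

/-- **The ladder is a ladder** (registered margin): a tower of depth `K'` is a tower of every depth
`K ≤ K'`. [folklore] -/
theorem DepthTower.mono {ν : ℝ} {R : TowerRates} {P : Registry R} {V : ClayEnvelope} {κ : ℝ}
    {K K' : ℕ} (hK : K ≤ K') (h : DepthTower ν R P V (Margins.tower R κ) K') :
    DepthTower ν R P V (Margins.tower R κ) K := by
  obtain ⟨S, hS, ⟨s⟩⟩ := h
  exact ⟨S, hS, ⟨s.restrict hK⟩⟩

/-- A coherent tower has every finite depth (within its own envelope). [folklore] -/
theorem CoherentTower.uniformDepthTowers {ν : ℝ} {R : TowerRates} {P : Registry R}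
    {m : Margins R} (h : CoherentTower ν R P m) : UniformDepthTowers ν R P m := by
  obtain ⟨V, S, hS, s, _⟩ := h
  exact ⟨V, fun K => ⟨S, hS, ⟨s K⟩⟩⟩

/-! ## §5 Heredity of the produced object's class -/

/-- **Base in a design class `𝒟`** (open for any serious `𝒟`; never asserted): some conforming
schedule IN `𝒟` admits a stage at level `1`. `𝒟` = the constructor's explicit family of data and
forces, registered when a mechanism of record exists. [cite: Palasek2026ElementaryModel, §4] -/
@[conjecture] def BaseIn (ν : ℝ) (R : TowerRates) (P : Registry R) (V : ClayEnvelope)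
    (m : Margins R) (𝒟 : Schedule R → Prop) : Prop :=
  ∃ S : Schedule R, 𝒟 S ∧ S.Conforms P V ∧ Nonempty (Stage ν R S m 1)

/-- **Heredity in a design class `𝒟`** (open; never asserted; repair R-d made literal — the
induction is stated for the CLASS of the produced object): every stage of every conforming
schedule in `𝒟` extends by one level. The smaller `𝒟`, the weaker (and more plausible) the claim;
`𝒟 = ⊤` gives back the schedule-universal induction. [cite: Palasek2026ElementaryModel, §4] -/
@[conjecture] def HereditaryIn (ν : ℝ) (R : TowerRates) (P : Registry R) (V : ClayEnvelope)
    (m : Margins R) (𝒟 : Schedule R → Prop) : Prop :=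
  ∀ S : Schedule R, 𝒟 S → S.Conforms P V → ∀ (n : ℕ) (s : Stage ν R S m (n + 1)),
    ∃ s' : Stage ν R S m (n + 1 + 1), s.Extends s'

open Assembly in
/-- **Base + heredity in a design class give a coherent tower** (choice along `ℕ`, by the landed
`Assembly.chain`), hence the interface (`nonempty_realisation_of_chain`, sibling file) with
no compactness at all. [folklore] -/
theorem coherentTower_of_hereditaryIn {ν : ℝ} {R : TowerRates} {P : Registry R} {V : ClayEnvelope}
    {m : Margins R} {𝒟 : Schedule R → Prop} (h₁ : BaseIn ν R P V m 𝒟)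
    (h₂ : HereditaryIn ν R P V m 𝒟) : CoherentTower ν R P m := by
  obtain ⟨S, hD, hS, ⟨s₁⟩⟩ := h₁
  have step : ∀ n, ∀ s : Stage ν R S m (n + 1), ∃ s' : Stage ν R S m (n + 1 + 1), s.Extends s' :=
    fun n s => h₂ S hD hS n s
  exact ⟨V, S, hS, chain s₁ step, chain_extends s₁ step⟩

/-- **Base + heredity in a design class give towers of every depth** (K1R-E). [folklore] -/
theorem uniformDepthTowers_of_hereditaryIn {ν : ℝ} {R : TowerRates} {P : Registry R}
    {V : ClayEnvelope} {m : Margins R} {𝒟 : Schedule R → Prop} (h₁ : BaseIn ν R P V m 𝒟)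
    (h₂ : HereditaryIn ν R P V m 𝒟) : UniformDepthTowers ν R P m :=
  (coherentTower_of_hereditaryIn h₁ h₂).uniformDepthTowers

/-! ## §6 Non-vacuity of the registry -/

namespace TowerRates

/-- **Deep-base rates** (`N₀ = 65536 = 2^{16}`, exponents `11/10`, `23/10`, `49/20` as in
`TowerRates.canonical` / `TowerRates.wide`): consecutive velocity scales are separated by
`N₀^{(b-1)(β-1)} = 2^{2.08} ≥ 4`, enough for a ceiling twice the floor AND a separation factor `2`
(Palasek takes `N₀` large). [cite: Palasek2026ElementaryModel, §3.1] -/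
def deep : TowerRates where
  N₀ := 65536
  b := 11 / 10
  β := 23 / 10
  α := 49 / 20
  one_lt_N₀ := by norm_num
  one_lt_b := by norm_num
  two_b_lt_β := by norm_num
  β_lt_α := by norm_num
  two_lt_α := by norm_num
  α_le := by norm_num
  β_lt_one_add_sqrt_two := by
    have h : (7 : ℝ) / 5 < Real.sqrt 2 := by
      rw [Real.lt_sqrt (by norm_num)]
      norm_num
    linarith

/-- For the deep-base record every level at least QUADRUPLES the velocity scale: `4 Y_k ≤ Y_{k+1}`
(`65536^{13/100} = 2^{208/100} ≥ 2² = 4`). [folklore] -/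
theorem deep_sep (k : ℕ) : 4 * deep.Y k ≤ deep.Y (k + 1) := by
  -- `Y_{k+1} = N_k^{(b-1)(β-1)} · Y_k` (from `N_{k+1} = N_k^b`)
  have hsucc : deep.Y (k + 1) = deep.N k ^ ((deep.b - 1) * (deep.β - 1)) * deep.Y k := by
    simp only [TowerRates.Y]
    rw [deep.N_succ k, ← Real.rpow_mul (deep.N_pos k).le, ← Real.rpow_add (deep.N_pos k)]
    congr 1
    ring
  rw [hsucc]
  have hY : 0 < deep.Y k := Real.rpow_pos_of_pos (deep.N_pos k) _
  refine mul_le_mul_of_nonneg_right ?_ hY.le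
  have hexp : (deep.b - 1) * (deep.β - 1) = 13 / 100 := by
    simp only [deep]; norm_num
  -- `N₀ ≤ N_k` and `N₀ = 2^16`
  have hN₀ : deep.N₀ ≤ deep.N k := by
    simp only [TowerRates.N]
    conv_lhs => rw [← Real.rpow_one deep.N₀]
    exact Real.rpow_le_rpow_of_exponent_le deep.one_lt_N₀.le (one_le_pow₀ deep.one_lt_b.le)
  have hN : deep.N₀ = (2 : ℝ) ^ (16 : ℝ) := by
    simp only [deep]; norm_num
  rw [hexp]
  calc (4 : ℝ) = (2 : ℝ) ^ (2 : ℝ) := by norm_num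
    _ ≤ (2 : ℝ) ^ ((16 : ℝ) * (13 / 100)) :=
        Real.rpow_le_rpow_of_exponent_le (by norm_num) (by norm_num)
    _ = deep.N₀ ^ ((13 : ℝ) / 100) := by rw [hN, ← Real.rpow_mul (by norm_num : (0 : ℝ) ≤ 2)]
    _ ≤ deep.N k ^ ((13 : ℝ) / 100) :=
        Real.rpow_le_rpow (le_trans zero_le_one deep.one_lt_N₀.le) hN₀ (by norm_num)

end TowerRates

/-- **A registry for the deep-base rates** (`TowerRates.deep`): `c₁ = 1`, `c₂ = 2` (ceiling twice
the floor), `c₃ = c₄ = c₅ = 1`, `radius = 1`, impulse number `Λ = 4` (refuter asked `≥ 3`),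
separation `θ = 2` (so the separation pin reads `4 Y_k ≤ Y_{k+1}`, carried at every level by
`TowerRates.deep_sep`), persistence `κ = 1/2`. The typist's default; the cell registers its numbers
before filing. [folklore] -/
def Registry.deep : Registry TowerRates.deep where
  c₁ := 1
  c₂ := 2
  c₃ := 1
  c₄ := 1
  c₅ := 1
  radius := 1
  Λ := 4
  θ := 2
  κ := 1 / 2
  c₁_pos := by norm_num
  c₁_le_c₂ := by norm_num
  radius_pos := by norm_num
  Λ_nonneg := by norm_num
  one_le_θ := by norm_num
  κ_pos := by norm_num

/-- The registered separation of `Registry.deep` is carried by the rates at every level: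
`θ (c₂ Y_k) ≤ c₁ Y_{k+1}`, i.e. `4 Y_k ≤ Y_{k+1}` (`TowerRates.deep_sep`). [folklore] -/
theorem Registry.deep_sep (k : ℕ) :
    Registry.deep.θ * (Registry.deep.c₂ * TowerRates.deep.Y k) ≤
      Registry.deep.c₁ * TowerRates.deep.Y (k + 1) := by
  have h := TowerRates.deep_sep k
  have e : Registry.deep.θ * (Registry.deep.c₂ * TowerRates.deep.Y k) = 4 * TowerRates.deep.Y k := by
    simp only [Registry.deep]; ring
  rw [e]
  simpa [Registry.deep] using h

end Summit.NavierStokesRegularity.FluidComputer.PalasekTowerClayBridge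

end
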